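import Mathlib
import Summits.KontsevichZagierPeriods.KontsevichZagierPeriods.Theorems.TorsionLogsGKZLevelThreePairBetaCubic

/-!
# Route TorsionLogs — support item `GKZLevelThreePair`: Euler's reflection at `1/3`, II
# (`B(2/3,1/3)` carried to the arctangent arc `[(0,√3), 2√3/(1+x²)]`)

Helper file for item `stmt-KontsevichZagierPeriods-13812` (`GKZLevelThreePair`), step (S6) of the
prover's blueprint, continuing `TorsionLogsGKZLevelThreePairBetaCubic.lean`
(`[(0,1), 3w/(3w²-3w+1)] ∼ Brep = [(0,1), s^{-1/3}(1-s)^{-2/3}]`):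

* `cubicRational_equivalent_half` — the symmetry `w ↦ 1-w` of `q(w) = 3w²-3w+1`: split at `1/2`
  (rule 1a)), reflect the upper half (rule 2)), add the integrands (rule 1b)):
  `[(0,1), 3w/q] ∼ [(0,1/2), 3/q]`;
* `arctanArc_equivalent_half` — the affine substitution `w = 1/2 - x/(2√3)` (rule 2)), under which
  `q = (1+x²)/4`: `[(0,√3), 2√3/(1+x²)] ∼ [(0,1/2), 3/q]`;
* `beta_equivalent_arctanArc` — the composite `Brep ∼ [(0,√3), 2√3/(1+x²)]`
  (value `B(2/3,1/3) = 2√3 · arctan √3 = 2π/√3`), five moves in all.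

All representations are PINNED by their domain and their integrand on it. The companion file
`TorsionLogsGKZLevelThreePairBetaDisc.lean` finishes `Brep ∼ [unit disc, 2/√3]`, which is also the
instance `a = 2/3` of item `EulerReflectionRational` (stmt-KontsevichZagierPeriods-3383, route
CompiledSubstitutions).

## References

* M. Kontsevich, D. Zagier, *Periods* (2001), §1.1 (`π = ∬_{x²+y²≤1} = ∫ dx/(1+x²)`), §1.2 rules
  (1)–(3).
* G. Andrews, R. Askey, R. Roy, *Special Functions* (1999), Thm. 1.2.1 (Euler's reflection formula).
-/

-- `Summit.<Summit>.<Sub>` with Sub = Summit (single-conjunct summit, D-0017) duplicates the segment.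
set_option linter.dupNamespace false

noncomputable section

namespace Summit.KontsevichZagierPeriods.KontsevichZagierPeriods.Theorems.GKZLevelThree

open Set MeasureTheory
open MvPolynomial (aeval X C)
open Literature.NumberTheory.Transcendental Literature.NumberTheory.Transcendental.KZ
open Literature.ModelTheory.ExponentialFields (IsSemialgebraic isSemialgebraic_setOf_eval_pos)
open Summit.KontsevichZagierPeriods.HermiteRigidity.CMTwistQuasiPeriodTransfer
  (isSemialgebraic_setOf_apply_lt_of_isAlgebraic isSemialgebraic_setOf_apply_gt_of_isAlgebraic
    of_sub_of_mem_changeOfVariablesRel_dimOne of_sub_of_sub_mem_relations_split)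

/-! ## Step 2: the symmetry `w ↦ 1 - w` halves the interval -/

/-- **Step 2.** `[(0,1), 3w/q] ∼ [(0,1/2), 3/q]`, `q = 3w²-3w+1 = q(1-w)`: split at the algebraic
abscissa `1/2` (rule 1a)), carry the upper half to `[(0,1/2), 3(1-w)/q]` by the reflection
`w ↦ 1-w` (rule 2)), and add `3w/q + 3(1-w)/q = 3/q` (rule 1b)).
[Kontsevich–Zagier 2001, §1.2 rules (1), (2)] -/
theorem cubicRational_equivalent_half (W H : IntegralRep 1)
    (hWd : W.domain = {x | x 0 ∈ Set.Ioo (0:ℝ) 1})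
    (hWi : EqOn W.integrand (fun x => 3 * x 0 / (3 * x 0 ^ 2 - 3 * x 0 + 1)) W.domain)
    (hHd : H.domain = {x : Fin 1 → ℝ | 0 < x 0 ∧ x 0 < 1 / 2})
    (hHi : EqOn H.integrand (fun x => 3 / (3 * x 0 ^ 2 - 3 * x 0 + 1)) H.domain) :
    Equivalent W H := by
  have hhalf : IsAlgebraic ℚ ((1:ℝ) / 2) := by
    simpa using isAlgebraic_algebraMap (R := ℚ) (A := ℝ) (1 / 2 : ℚ)
  -- the two halves of `W`
  have hs₁ : IsSemialgebraic ℚ (W.domain ∩ {p : Fin 1 → ℝ | p 0 < 1 / 2}) :=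
    W.isSemialgebraic_domain.inter (isSemialgebraic_setOf_apply_lt_of_isAlgebraic hhalf 0)
  have hs₂ : IsSemialgebraic ℚ (W.domain ∩ {p : Fin 1 → ℝ | 1 / 2 < p 0}) :=
    W.isSemialgebraic_domain.inter (isSemialgebraic_setOf_apply_gt_of_isAlgebraic hhalf 0)
  set W₁ := W.restrict _ hs₁ inter_subset_left with hW₁
  set W₂ := W.restrict _ hs₂ inter_subset_left with hW₂
  have hsplit : of W - of W₁ - of W₂ ∈ relations :=
    of_sub_of_sub_mem_relations_split W W₁ W₂ hhalf rfl rfl (fun _ _ => rfl) (fun _ _ => rfl)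
  have hW₁d : W₁.domain = {x : Fin 1 → ℝ | 0 < x 0 ∧ x 0 < 1 / 2} := by
    rw [hW₁, IntegralRep.domain_restrict, hWd]
    ext x
    simp only [mem_inter_iff, mem_setOf_eq, mem_Ioo]
    constructor
    · rintro ⟨⟨h1, -⟩, h2⟩; exact ⟨h1, h2⟩
    · rintro ⟨h1, h2⟩; exact ⟨⟨h1, by linarith⟩, h2⟩
  have hW₂d : W₂.domain = {x : Fin 1 → ℝ | 1 / 2 < x 0 ∧ x 0 < 1} := by
    rw [hW₂, IntegralRep.domain_restrict, hWd]
    ext x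
    simp only [mem_inter_iff, mem_setOf_eq, mem_Ioo]
    constructor
    · rintro ⟨⟨-, h1⟩, h2⟩; exact ⟨h2, h1⟩
    · rintro ⟨h1, h2⟩; exact ⟨⟨by linarith, h2⟩, h1⟩
  -- the reflected upper half `W₂' = [(0,1/2), 3(1-w)/q]`
  obtain ⟨W₂', hW₂'d, hW₂'i⟩ : ∃ r : IntegralRep 1, r.domain = {x : Fin 1 → ℝ | 0 < x 0 ∧ x 0 < 1 / 2} ∧
      r.integrand = fun x => 3 * (1 - x 0) / (3 * x 0 ^ 2 - 3 * x 0 + 1) := by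
    refine exists_rep_Ioo₁ isAlgebraic_zero hhalf (fun w => 3 * (1 - w) / (3 * w ^ 2 - 3 * w + 1))
      ((by fun_prop : Continuous fun w : ℝ => 3 * (1 - w)).continuousOn.div (by fun_prop)
        fun w _ => (cubicDen_pos w).ne') ?_
    refine isSemialgebraicFunOn_ratFun₁ (((KZ.isSemialgebraic_setOf_const_lt_apply isAlgebraic_zero 0).inter (KZ.isSemialgebraic_setOf_apply_lt_const hhalf 0)))
      (C 3 * (1 - X 0)) (C 3 * X 0 ^ 2 - C 3 * X 0 + 1)
      (fun w => 3 * (1 - w) / (3 * w ^ 2 - 3 * w + 1)) (fun x _ => ?_) (fun x _ => ?_)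
    · simp only [map_add, map_sub, map_mul, map_pow, MvPolynomial.aeval_C, MvPolynomial.aeval_X,
        map_one, eq_ratCast, Rat.cast_ofNat]
      exact (cubicDen_pos (x 0)).ne'
    · simp
  have hrefl : of W₂' - of W₂ ∈ relations := by
    refine of_sub_of_mem_relations_of_boxReflection (0 : Fin 1) ?_ fun x hx => ?_
    · rw [hW₂'d, hW₂d]
      ext x
      simp only [mem_setOf_eq, mem_preimage, boxReflection_apply_self]
      constructor <;> rintro ⟨h1, h2⟩ <;> constructor <;> linarith
    · have hx' : 0 < x 0 ∧ x 0 < 1 / 2 := by rw [hW₂'d] at hx; exact hx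
      have hmem : boxReflection (0 : Fin 1) x ∈ W.domain := by
        rw [hWd]
        show boxReflection 0 x 0 ∈ Ioo (0:ℝ) 1
        rw [boxReflection_apply_self]
        exact ⟨by linarith [hx'.2], by linarith [hx'.1]⟩
      rw [hW₂'i, hW₂, IntegralRep.integrand_restrict, hWi hmem]
      simp only [boxReflection_apply_self]
      ring
  -- integrand additivity on `(0,1/2)`
  have hadd : of H - of W₁ - of W₂' ∈ relations := by
    refine integrandAddRel_subset_relations ⟨1, H, W₁, W₂', by rw [hW₁d, hHd], by rw [hW₂'d, hHd],
      fun x hx => ?_, rfl⟩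
    have hx' : 0 < x 0 ∧ x 0 < 1 / 2 := by rw [hHd] at hx; exact hx
    have hmem : x ∈ W.domain := by rw [hWd]; exact ⟨hx'.1, by linarith [hx'.2]⟩
    rw [hHi hx, Pi.add_apply, hW₁, IntegralRep.integrand_restrict, hWi hmem, hW₂'i]
    have hq : (3 * x 0 ^ 2 - 3 * x 0 + 1) ≠ 0 := (cubicDen_pos (x 0)).ne'
    field_simp
    ring
  have : of W - of H = (of W - of W₁ - of W₂) - (of H - of W₁ - of W₂') - (of W₂' - of W₂) := by abel
  show of W - of H ∈ relations
  rw [this]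
  exact relations.sub_mem (relations.sub_mem hsplit hadd) hrefl

/-! ## Step 3: the affine substitution `w = 1/2 - x/(2√3)` -/

/-- `√3` is algebraic over `ℚ` (a root of `X² - 3`). -/
theorem isAlgebraic_sqrt_three : IsAlgebraic ℚ (Real.sqrt 3) := by
  refine ⟨Polynomial.X ^ 2 - Polynomial.C (3 : ℚ), ?_, ?_⟩
  · exact Polynomial.X_pow_sub_C_ne_zero (by norm_num) _
  · simp only [map_sub, map_pow, Polynomial.aeval_X, Polynomial.aeval_C,
      Real.sq_sqrt (show (0:ℝ) ≤ 3 by norm_num)]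
    simp

/-- **Step 3.** `[(0,√3), 2√3/(1+x²)] ∼ [(0,1/2), 3/(3w²-3w+1)]` by the affine substitution
`w = 1/2 - x/(2√3)` (rule 2); `3w²-3w+1 = (1+x²)/4`, `|dw/dx| = 1/(2√3)`).
[Kontsevich–Zagier 2001, §1.2 rule (2)] -/
theorem arctanArc_equivalent_half (A H : IntegralRep 1)
    (hAd : A.domain = {x : Fin 1 → ℝ | 0 < x 0 ∧ x 0 < Real.sqrt 3})
    (hAi : EqOn A.integrand (fun x => 2 * Real.sqrt 3 / (1 + x 0 ^ 2)) A.domain)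
    (hHd : H.domain = {x : Fin 1 → ℝ | 0 < x 0 ∧ x 0 < 1 / 2})
    (hHi : EqOn H.integrand (fun x => 3 / (3 * x 0 ^ 2 - 3 * x 0 + 1)) H.domain) :
    Equivalent A H := by
  have h3 : 0 < Real.sqrt 3 := Real.sqrt_pos.2 (by norm_num)
  have h3sq : Real.sqrt 3 ^ 2 = 3 := Real.sq_sqrt (by norm_num)
  have h23 : (2 * Real.sqrt 3) ≠ 0 := by positivity
  have h2alg : IsAlgebraic ℚ (2:ℝ) := by simpa using isAlgebraic_nat (R := ℚ) (A := ℝ) 2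
  have hc : IsAlgebraic ℚ (1 / (2 * Real.sqrt 3)) := by
    rw [one_div]
    exact (h2alg.mul isAlgebraic_sqrt_three).inv
  have hhalf : IsAlgebraic ℚ ((1:ℝ) / 2) := by
    simpa using isAlgebraic_algebraMap (R := ℚ) (A := ℝ) (1 / 2 : ℚ)
  set φ : ℝ → ℝ := fun x => 1 / 2 - x / (2 * Real.sqrt 3) with hφ
  set φ' : ℝ → ℝ := fun _ => -(1 / (2 * Real.sqrt 3)) with hφ'
  -- the denominator after substitution
  have hq : ∀ x : ℝ, 3 * φ x ^ 2 - 3 * φ x + 1 = (1 + x ^ 2) / 4 := by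
    intro x
    have h1 : 3 * φ x ^ 2 - 3 * φ x + 1 = 3 * (φ x - 1 / 2) ^ 2 + 1 / 4 := by ring
    have h2 : φ x - 1 / 2 = -(x / (2 * Real.sqrt 3)) := by simp only [hφ]; ring
    rw [h1, h2, neg_sq, div_pow, mul_pow, h3sq]
    ring
  refine changeOfVariablesRel_subset_relations
    (of_sub_of_mem_changeOfVariablesRel_dimOne A H φ φ' ?_ ?_ ?_ ?_ ?_)
  · -- semialgebraic
    have hs := A.isSemialgebraic_domain
    have h1 : IsSemialgebraicFunOn ℚ A.domain (fun _ => (1:ℝ) / 2) :=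
      isSemialgebraicFunOn_const_of_isAlgebraic hs hhalf
    have h2 : IsSemialgebraicFunOn ℚ A.domain (fun _ => 1 / (2 * Real.sqrt 3)) :=
      isSemialgebraicFunOn_const_of_isAlgebraic hs hc
    have h3' : IsSemialgebraicFunOn ℚ A.domain (fun p => p 0) :=
      (isSemialgebraicFunOn_aeval hs (X 0 : MvPolynomial (Fin 1) ℚ)).congr fun z _ => by simp
    exact (IsSemialgebraicFunOn.sub_holds h1 (IsSemialgebraicFunOn.mul_holds h2 h3')).congr
      fun p _ => by simp only [hφ, Pi.sub_apply, Pi.mul_apply]; ring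
  · -- derivative
    intro p _
    have h := ((hasDerivAt_id' (p 0)).div_const (2 * Real.sqrt 3)).const_sub (1 / 2)
    exact h.congr_deriv (by simp [hφ'])
  · -- injective
    intro p _ q _ h
    have h' : p 0 / (2 * Real.sqrt 3) = q 0 / (2 * Real.sqrt 3) := by
      simp only [hφ] at h; linarith
    field_simp at h'
    linarith
  · -- image
    rw [hHd, hAd]
    ext w
    simp only [mem_setOf_eq, mem_image]
    constructor
    · rintro ⟨hw0, hw1⟩
      refine ⟨fun _ => Real.sqrt 3 * (1 - 2 * w 0), ⟨by nlinarith, by nlinarith⟩, ?_⟩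
      funext i
      rw [Subsingleton.elim i 0]
      simp only [hφ]
      field_simp
      ring
    · rintro ⟨p, ⟨hp0, hp1⟩, rfl⟩
      simp only [hφ]
      constructor
      · rw [sub_pos, div_lt_iff₀ (by positivity)]
        linarith
      · have : 0 < p 0 / (2 * Real.sqrt 3) := by positivity
        linarith
  · -- integrands
    intro p hp
    have hp' : 0 < p 0 ∧ p 0 < Real.sqrt 3 := by rw [hAd] at hp; exact hp
    have hφp : (fun _ : Fin 1 => φ (p 0)) ∈ H.domain := by
      rw [hHd]
      refine ⟨?_, ?_⟩
      · show 0 < φ (p 0)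
        simp only [hφ]
        rw [sub_pos, div_lt_iff₀ (by positivity)]
        linarith [hp'.2]
      · show φ (p 0) < 1 / 2
        have : 0 < p 0 / (2 * Real.sqrt 3) := by have := hp'.1; positivity
        simp only [hφ]
        linarith
    rw [hAi hp, hHi hφp]
    show 2 * Real.sqrt 3 / (1 + p 0 ^ 2) =
      3 / (3 * φ (p 0) ^ 2 - 3 * φ (p 0) + 1) * |(-(1 / (2 * Real.sqrt 3)))|
    rw [hq, abs_neg, abs_of_pos (by positivity)]
    have h1x : (1 + p 0 ^ 2) ≠ 0 := by positivity
    field_simp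
    nlinarith [h3sq]

/-- `[(0,1/2), 3/(3w²-3w+1)]` exists. -/
theorem exists_halfRep : ∃ H : IntegralRep 1, H.domain = {x : Fin 1 → ℝ | 0 < x 0 ∧ x 0 < 1 / 2} ∧
    H.integrand = fun x => 3 / (3 * x 0 ^ 2 - 3 * x 0 + 1) := by
  have hhalf : IsAlgebraic ℚ ((1:ℝ) / 2) := by
    simpa using isAlgebraic_algebraMap (R := ℚ) (A := ℝ) (1 / 2 : ℚ)
  refine exists_rep_Ioo₁ isAlgebraic_zero hhalf (fun w => 3 / (3 * w ^ 2 - 3 * w + 1))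
    (continuousOn_const.div (by fun_prop) fun w _ => (cubicDen_pos w).ne') ?_
  refine isSemialgebraicFunOn_ratFun₁ (((KZ.isSemialgebraic_setOf_const_lt_apply isAlgebraic_zero 0).inter (KZ.isSemialgebraic_setOf_apply_lt_const hhalf 0)))
    (C 3) (C 3 * X 0 ^ 2 - C 3 * X 0 + 1) (fun w => 3 / (3 * w ^ 2 - 3 * w + 1))
    (fun x _ => ?_) (fun x _ => ?_)
  · simp only [map_add, map_sub, map_mul, map_pow, MvPolynomial.aeval_C, MvPolynomial.aeval_X,
      map_one, eq_ratCast, Rat.cast_ofNat]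
    exact (cubicDen_pos (x 0)).ne'
  · simp

/-- **`B(2/3,1/3)` as an arctangent arc, inside the rules**: every Beta representation
`[(0,1), s^{-1/3}(1-s)^{-2/3}]` (value `Γ(2/3)Γ(1/3) = 2π/√3`) is KZ-equivalent to every arctangent
arc `[(0,√3), 2√3/(1+x²)]` (value `2√3 · arctan √3 = 2π/√3`): Steps 1–3, five moves in all.
[Kontsevich–Zagier 2001, §1.2; Andrews–Askey–Roy 1999, Thm. 1.2.1] -/
theorem beta_equivalent_arctanArc (β A : IntegralRep 1)
    (hβd : β.domain = {x | x 0 ∈ Set.Ioo (0:ℝ) 1})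
    (hβi : EqOn β.integrand (fun x => (x 0) ^ (-(1:ℝ) / 3) * (1 - x 0) ^ (-(2:ℝ) / 3)) β.domain)
    (hAd : A.domain = {x : Fin 1 → ℝ | 0 < x 0 ∧ x 0 < Real.sqrt 3})
    (hAi : EqOn A.integrand (fun x => 2 * Real.sqrt 3 / (1 + x 0 ^ 2)) A.domain) :
    Equivalent β A := by
  obtain ⟨W, hWd, hWi⟩ := exists_cubicRationalRep
  obtain ⟨H, hHd, hHi⟩ := exists_halfRep
  have h1 : Equivalent W β := cubicRational_equivalent_beta W β hWd (fun x _ => by rw [hWi]) hβd hβi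
  have h2 : Equivalent W H := cubicRational_equivalent_half W H hWd (fun x _ => by rw [hWi]) hHd
    (fun x _ => by rw [hHi])
  have h3 : Equivalent A H := arctanArc_equivalent_half A H hAd hAi hHd (fun x _ => by rw [hHi])
  exact (h1.symm.trans h2).trans h3.symm


end Summit.KontsevichZagierPeriods.KontsevichZagierPeriods.Theorems.GKZLevelThree

end
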